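import Literature.AlgebraicGeometry.Motives.FrobIntegralPartLargestEffectiveTwistSubspace
import Literature.AlgebraicGeometry.Motives.KahnSemisimplicityTheoremSelfProduct
import Mathlib.RingTheory.Radical.Basic
import HarnessLib

/-!
# `F^r_b Hⁱ(X) = Hⁱ(X)` iff `Hⁱ(X)(r)` is an effective SEMISIMPLE Tate structure; for `r = 0`:
# `F^0_b Hⁱ(X) = Hⁱ(X) ⟺ SS^i(X)` (Milne–Ramachandran 2006 §1.1, Rem. 1.4), hence under `S^d(X × X)`

Topic `Literature/AlgebraicGeometry/Motives`; THEOREMS ONLY (no definition, no instance, no named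
fact; D-0026).

J. S. Milne, N. Ramachandran, *Motivic complexes over finite fields and the ring of correspondences at
the generic point*, arXiv:math/0607483 [MilneRamachandran2006] §1 (held text, chunk p0003):
* §1.1 (L31–L45): «Define a Tate structure to be a finite-dimensional `ℚ_l`-vector space with a linear
  (Frobenius) map `ϖ` whose characteristic polynomial lies in `ℚ[T]` and whose eigenvalues are Weil
  `q`-numbers […]. When the eigenvalues are all of weight `m` (resp. algebraic integers, resp.
  semisimple), we say that `V` is of weight `m` (resp. effective, resp. semisimple). For example, for
  any smooth complete variety `X` over `k`, `Hⁱ_l(X)` is an effective Tate structure of weight `i/2`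
  ([deligne1980]), which is semisimple if `X` is an abelian variety ([weil1948], no. 70) or if the full
  Tate conjecture holds for `X × X` ([milne1986v], 8.6).»
* Rem. 1.4 (L77–L88): «[`F^r_b Hⁱ_l(X)`] is the largest semisimple Tate substructure of `Hⁱ_l(X)` whose
  twist by `ℚ_l(r)` is still effective».

So `F^r_b Hⁱ(X)` is ALL of `Hⁱ(X)` exactly when `Hⁱ(X)(r)` itself is an effective semisimple Tate
structure; for `r = 0`, where effectivity is Deligne's integrality of the eigenvalues of Frobenius, this
says `F^0_b Hⁱ(X) = Hⁱ(X) ⟺ ϖ` acts semisimply on `Hⁱ(X)` — the tree's `SS^i(X)`,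
`Module.End.IsSemisimple (E.frobAction X i)` (`Motives/FrobeniusSemisimpleIffSelfProductStrongTate`) —,
which holds under Kahn 2020 Th. 6.54's `S^d(X × X)` (row g39-#7,
`isSemisimple_frobAction_of_strongTate_self_product`).  For the abstract `E : GaloisWeilCohomology k K χ`
over a finite field `k` (tree vocabulary: `E.frobIntegralPart X i r = F^r_b Hⁱ(X)`,
`E.IsEffectiveTwistSubspace`, `E.frobenius X i = E.frobAction X i = ρ(F)`, `ϖ_r = (q⁻¹)^r • ϖ`,
`E.IsIntegralModel X i P` : `P ∈ ℤ[T]` maps to `det(1 − T ϖ | Hⁱ(X))`) this file proves: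

* §1 (pure algebra) an integral model of `det(1 − T ϖ)` for invertible `ϖ` gives a MONIC `R ∈ ℤ[T]`
  mapping to `charpoly ϖ` (its reverse; `exists_monic_map_eq_charpoly_of_reverse`); and **a semisimple
  endomorphism killed by a monic integer polynomial is killed by one that is squarefree over `ℚ`**
  (`exists_monic_squarefree_aeval_eq_zero_of_isSemisimple`: the radical of `R` over `ℚ`, integral by
  Gauss's lemma, kills `ϖ` because the squarefree minimal polynomial divides `R ∣ rad(R)^n`).
* §2 **`F^r_b Hⁱ(X) = Hⁱ(X) ⟺ (ϖ semisimple ∧ ϖ_r killed by a monic integer polynomial)`** for `X`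
  smooth projective (`frobIntegralPart_eq_top_iff`; «effective semisimple Tate structure»); in
  particular `F^r_b Hⁱ(X) = Hⁱ(X) ⟹ SS^i(X)` (`isSemisimple_frobAction_of_frobIntegralPart_eq_top`,
  row g39-#9: one squarefree polynomial kills `ϖ_r` on `F_b`).
* §3 **`r = 0`: `F^0_b Hⁱ(X) = Hⁱ(X) ⟺ SS^i(X)`** given an integral model of `P_i(X, T)`
  (`frobIntegralPart_zero_eq_top_iff`), e.g. under `E.WeilRiemannHypothesisFor X d`
  (`frobIntegralPart_zero_eq_top_iff_of_weilRiemannHypothesis`; degrees `i > 2d` are trivial,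
  `frobIntegralPart_eq_top_of_lt`), and **`S^d(X × X) ⟹ F^0_b Hⁱ(X) = Hⁱ(X)` for all `i`**
  (`frobIntegralPart_zero_eq_top_of_strongTate_self_product`; §1.1 «semisimple if the full Tate
  conjecture holds for `X × X`» in Kahn's sharper form, Th. 6.54).

What is NOT here: the abelian-variety case of §1.1 ([weil1948] no. 70) — the abstract `E` has no bridge
to the tree's Tate-module files.  HC is not touched.

## References

* [MilneRamachandran2006] J. S. Milne, N. Ramachandran, arXiv:math/0607483, §1.1 and Rem. 1.4.
* [Kahn2020] B. Kahn, *Zeta and L-functions of varieties and motives*, CUP (2020), §6.14 Th. 6.54.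
* [Deligne1974] P. Deligne, *La conjecture de Weil. I*, Thm. (1.6) (integrality and weights).
* [Tate1994] J. Tate, *Conjectures on algebraic cycles in ℓ-adic cohomology*, §1.

## Provenance

Lane `lit-hodgefound` (summit `HodgeConjecture`, Track 2 foundations library, Layer B: motives),
seat `lit-hodgefound-p29` (literature-prover, generation 39, row g39-#10).
-/

noncomputable section

open Polynomial UniqueFactorizationMonoid CategoryTheory MonoidalCategory

universe u v

namespace Literature.AlgebraicGeometry.Motives

/-! ### §1 Integral models and squarefree integral annihilators of semisimple endomorphisms -/

section Pure

/-- **An integral model of `det(1 − T ϖ)` gives a monic integral model of `charpoly ϖ`** for an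
invertible endomorphism `ϖ` of a finite-dimensional space over a field of characteristic `0`: if
`P ∈ ℤ[T]` maps to `reverse (charpoly ϖ)`, then `reverse P` is monic and maps to `charpoly ϖ` (the
constant coefficient `± det ϖ` of `charpoly ϖ` is nonzero).  §1.1: the characteristic polynomial of
the Frobenius of `Hⁱ_l(X)` «lies in `ℚ[T]`», with algebraic-integer roots ([deligne1980]).
[cite: MilneRamachandran2006, §1.1] [cite: Deligne1974, Thm. (1.6)] -/
theorem exists_monic_map_eq_charpoly_of_reverse {K : Type*} [Field K] [CharZero K] {V : Type*}
    [AddCommGroup V] [Module K V] [FiniteDimensional K V] (ϖ : Module.End K V) (hϖ : IsUnit ϖ)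
    {P : ℤ[X]} (hP : P.map (Int.castRingHom K) = ϖ.charpoly.reverse) :
    ∃ R : ℤ[X], R.Monic ∧ R.map (Int.castRingHom K) = ϖ.charpoly := by
  have hchar0 : ϖ.charpoly.coeff 0 ≠ 0 := by
    intro h
    have hdet := LinearMap.det_eq_sign_charpoly_coeff ϖ
    rw [h, mul_zero] at hdet
    exact (hϖ.map LinearMap.det).ne_zero hdet
  have hmapK : (P.map (Int.castRingHom K)).reverse = P.reverse.map (Int.castRingHom K) := by
    rw [reverse, reverse, natDegree_map_eq_of_injective (Int.castRingHom K).injective_int,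
      reflect_map]
  have hRK : P.reverse.map (Int.castRingHom K) = ϖ.charpoly := by
    rw [← hmapK, hP,
      Literature.Algebra.Polynomial.ReciprocalPolynomialSplits.reverse_reverse_of_coeff_zero_ne_zero
        hchar0]
  exact ⟨P.reverse,
    monic_of_injective (Int.castRingHom K).injective_int (hRK ▸ LinearMap.charpoly_monic ϖ), hRK⟩

/-- **A semisimple endomorphism killed by a monic integer polynomial `R` is killed by a monic integer
polynomial that is squarefree over `ℚ`** — namely by the radical of `R ⊗ ℚ` (monic, integral by
Gauss's lemma, Mathlib `IsIntegrallyClosed.eq_map_mul_C_of_dvd`): the minimal polynomial of a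
semisimple endomorphism is squarefree (Mathlib `Module.End.IsSemisimple.minpoly_squarefree`) and
divides `R ∣ rad(R)^n`, hence divides `rad(R)`.  (§1.1: «effective» and «semisimple» Tate structures;
Rem. 1.4's rendering in the tree by monic integer polynomials squarefree over `ℚ`.)
[cite: MilneRamachandran2006, §1.1 and Rem. 1.4] -/
theorem exists_monic_squarefree_aeval_eq_zero_of_isSemisimple {K : Type*} [Field K] [CharZero K]
    {V : Type*} [AddCommGroup V] [Module K V] [FiniteDimensional K V] (ϖ : Module.End K V)
    (hss : ϖ.IsSemisimple) {R : ℤ[X]} (hRm : R.Monic)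
    (hR : aeval ϖ (R.map (Int.castRingHom K)) = 0) :
    ∃ Q : ℤ[X], Q.Monic ∧ Squarefree (Q.map (Int.castRingHom ℚ)) ∧
      aeval ϖ (Q.map (Int.castRingHom K)) = 0 := by
  classical
  set Rℚ := R.map (Int.castRingHom ℚ) with hRℚ
  have hRℚm : Rℚ.Monic := hRm.map _
  have hRℚ0 : Rℚ ≠ 0 := hRℚm.ne_zero
  set G := radical Rℚ with hG
  have hGsq : Squarefree G := squarefree_radical
  have hGdvd : G ∣ Rℚ := radical_dvd_self
  obtain ⟨n, hn⟩ := exists_dvd_radical_self_pow hRℚ0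
  -- `G` is monic: a product of normalized (monic) factors
  have hGm : G.Monic := by
    rw [hG, radical]
    refine monic_prod_of_monic _ _ fun p hp ↦ ?_
    have hp' : p ∈ normalizedFactors Rℚ := mem_primeFactors.mp hp
    rw [← normalize_normalized_factor p hp']
    exact monic_normalize (prime_of_normalized_factor p hp').ne_zero
  -- Gauss's lemma: the monic divisor `G` of `R ⊗ ℚ` is integral
  obtain ⟨G', hG'⟩ :=
    IsIntegrallyClosed.eq_map_mul_C_of_dvd ℚ hRm (hGdvd : G ∣ R.map (algebraMap ℤ ℚ))
  rw [hGm.leadingCoeff, C_1, mul_one] at hG'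
  have hG'map : G'.map (Int.castRingHom ℚ) = G := hG'
  have hG'm : G'.Monic :=
    monic_of_injective (Int.castRingHom ℚ).injective_int (by rw [hG'map]; exact hGm)
  refine ⟨G', hG'm, by rw [hG'map]; exact hGsq, ?_⟩
  -- `minpoly ∣ R_K ∣ G_K ^ n` and `minpoly` is squarefree, so `minpoly ∣ G_K`
  rcases subsingleton_or_nontrivial (Module.End K V) with htriv | hnon
  · exact Subsingleton.elim _ _
  have hK : ∀ S : ℤ[X], (S.map (Int.castRingHom ℚ)).map (algebraMap ℚ K) =
      S.map (Int.castRingHom K) :=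
    fun S ↦ by rw [Polynomial.map_map]; congr 1; exact RingHom.ext_int _ _
  have hmin : minpoly K ϖ ∣ R.map (Int.castRingHom K) := minpoly.dvd K ϖ hR
  have hRG : R.map (Int.castRingHom K) ∣ (G'.map (Int.castRingHom K)) ^ n := by
    rw [← hK R, ← hK G', ← Polynomial.map_pow, hG'map]
    exact Polynomial.map_dvd (algebraMap ℚ K) hn
  have hn0 : n ≠ 0 := by
    rintro rfl
    rw [pow_zero] at hRG
    exact minpoly.not_isUnit K ϖ (isUnit_of_dvd_one (hmin.trans hRG))
  obtain ⟨H, hH⟩ : minpoly K ϖ ∣ G'.map (Int.castRingHom K) :=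
    (hss.minpoly_squarefree.dvd_pow_iff_dvd hn0).mp (hmin.trans hRG)
  rw [hH, map_mul, minpoly.aeval, zero_mul]

end Pure

/-! ### §2 `F^r_b Hⁱ(X) = Hⁱ(X)` iff `Hⁱ(X)(r)` is an effective semisimple Tate structure -/

namespace GaloisWeilCohomology

variable {k : Type u} [Field k] [Finite k] {K : Type v} [Field K] [CharZero K]
  {χ : Field.absoluteGaloisGroup k →* Kˣ} (E : GaloisWeilCohomology k K χ)
variable {d : ℕ} {X : SchemeOver k}

/-- `ϖ_0 = ϖ`: the `0`-th twist of the Frobenius is the Frobenius `E.frobAction X i`.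
[cite: MilneRamachandran2006, §1.1] -/
theorem smul_frobenius_zero (X : SchemeOver k) (i : ℕ) :
    ((Nat.card k : K)⁻¹ ^ 0) • E.frobenius X i = E.frobAction X i := by
  rw [pow_zero, one_smul, frobenius_eq_frobAction]

/-- **`F^r_b Hⁱ(X) = Hⁱ(X) ⟹ SS^i(X)`**: if the whole of `Hⁱ(X)` is the effective-twist part then the
Frobenius acts semisimply on `Hⁱ(X)` (`X` smooth projective: ONE polynomial squarefree over `ℚ` kills
`ϖ_r` on `F^r_b Hⁱ(X)`, row g39-#9; a nonzero scalar multiple of a semisimple endomorphism is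
semisimple).  Rem. 1.4: `F_b` is a «semisimple Tate substructure».
[cite: MilneRamachandran2006, §1.1 and Rem. 1.4] -/
theorem isSemisimple_frobAction_of_frobIntegralPart_eq_top (hX : IsSmoothProjective d X) {i r : ℕ}
    (h : E.frobIntegralPart X i r = ⊤) : Module.End.IsSemisimple (E.frobAction X i) := by
  obtain ⟨Q, -, hQs, hQ⟩ := E.exists_monic_squarefree_aeval_eq_zero_on_frobIntegralPart hX i r
  have hq : ((Nat.card k : K)⁻¹ ^ r) ≠ 0 :=
    pow_ne_zero _ (inv_ne_zero (by exact_mod_cast Nat.card_pos.ne'))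
  have hQK : Squarefree (Q.map (Int.castRingHom K)) := by
    have hmap : (Q.map (Int.castRingHom ℚ)).map (algebraMap ℚ K) = Q.map (Int.castRingHom K) := by
      rw [Polynomial.map_map]; congr 1; exact RingHom.ext_int _ _
    rw [← hmap]
    exact ((PerfectField.separable_iff_squarefree.mpr hQs).map).squarefree
  have hss : Module.End.IsSemisimple (((Nat.card k : K)⁻¹ ^ r) • E.frobenius X i) := by
    refine Module.End.isSemisimple_of_squarefree_aeval_eq_zero hQK ?_
    ext v
    exact hQ v (h ▸ Submodule.mem_top)
  rw [Module.End.IsSemisimple_smul_iff hq] at hss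
  rwa [← frobenius_eq_frobAction]

/-- **`F^r_b Hⁱ(X) = Hⁱ(X) ⟺ Hⁱ(X)(r)` is an effective semisimple Tate structure**, i.e. iff `ϖ` is
semisimple on `Hⁱ(X)` AND `ϖ_r = (q⁻¹)^r ϖ` is killed by a monic integer polynomial (its eigenvalues are
algebraic integers) — `X` smooth projective over the finite field `k`.  (§1.1 «effective, resp.
semisimple»; Rem. 1.4 «the largest semisimple Tate substructure whose twist by `ℚ_l(r)` is still
effective».) [cite: MilneRamachandran2006, §1.1 and Rem. 1.4] -/
theorem frobIntegralPart_eq_top_iff (hX : IsSmoothProjective d X) (i r : ℕ) :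
    E.frobIntegralPart X i r = ⊤ ↔
      Module.End.IsSemisimple (E.frobAction X i) ∧
        ∃ Q : ℤ[X], Q.Monic ∧
          aeval (((Nat.card k : K)⁻¹ ^ r) • E.frobenius X i) (Q.map (Int.castRingHom K)) = 0 := by
  haveI := E.finite_obj hX i
  constructor
  · intro h
    refine ⟨E.isSemisimple_frobAction_of_frobIntegralPart_eq_top hX h, ?_⟩
    obtain ⟨Q, hQm, -, hQ⟩ := E.exists_monic_squarefree_aeval_eq_zero_on_frobIntegralPart hX i r
    exact ⟨Q, hQm, LinearMap.ext fun v ↦ hQ v (h ▸ Submodule.mem_top)⟩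
  · rintro ⟨hss, Q, hQm, hQ⟩
    have hq : ((Nat.card k : K)⁻¹ ^ r) ≠ 0 :=
      pow_ne_zero _ (inv_ne_zero (by exact_mod_cast Nat.card_pos.ne'))
    have hss' : Module.End.IsSemisimple (((Nat.card k : K)⁻¹ ^ r) • E.frobenius X i) := by
      rw [Module.End.IsSemisimple_smul_iff hq, frobenius_eq_frobAction]; exact hss
    obtain ⟨Q', hQ'm, hQ's, hQ'⟩ :=
      exists_monic_squarefree_aeval_eq_zero_of_isSemisimple _ hss' hQm hQ
    refine eq_top_iff.mpr (E.le_frobIntegralPart ⟨fun v _ ↦ Submodule.mem_top, ⟨Q', hQ'm, hQ's, ?_⟩⟩)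
    intro v _
    rw [hQ', LinearMap.zero_apply]

/-! ### §3 `r = 0`: `F^0_b Hⁱ(X) = Hⁱ(X) ⟺ SS^i(X)`; hence under `S^d(X × X)` -/

/-- **A monic integral model of `charpoly (ϖ | Hⁱ(X))`** from an integral model of
`P_i(X, T) = det(1 − T ϖ | Hⁱ(X))` (`X` smooth projective; `ϖ = ρ(F)` is invertible).  §1.1: the
characteristic polynomial of the Frobenius «lies in `ℚ[T]`» and `Hⁱ_l(X)` is effective ([deligne1980]).
[cite: MilneRamachandran2006, §1.1] [cite: Deligne1974, Thm. (1.6)] -/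
theorem exists_monic_map_eq_charpoly_frobAction (hX : IsSmoothProjective d X) {i : ℕ} {P : ℤ[X]}
    (hP : E.IsIntegralModel X i P) :
    ∃ R : ℤ[X], R.Monic ∧
      R.map (Int.castRingHom K) = (haveI := E.finite_obj hX i; (E.frobAction X i).charpoly) := by
  haveI := E.finite_obj hX i
  have hunit : IsUnit (E.frobAction X i) := by
    rw [frobAction_def]; exact (Group.isUnit (geomFrob k)).map (E.ρ X i)
  have hmodel : P.map (Int.castRingHom K) = (E.frobAction X i).charpoly.reverse := by
    have h := hP
    rw [IsIntegralModel, E.frobCharPoly_eq hX] at h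
    exact h
  exact exists_monic_map_eq_charpoly_of_reverse _ hunit hmodel

/-- **`SS^i(X) ⟹ F^0_b Hⁱ(X) = Hⁱ(X)`** given an integral model of `P_i(X, T)` (`X` smooth projective):
`Hⁱ(X)` is then an effective semisimple Tate structure (Cayley–Hamilton and §1).
[cite: MilneRamachandran2006, §1.1 and Rem. 1.4] [cite: Deligne1974, Thm. (1.6)] -/
theorem frobIntegralPart_zero_eq_top_of_isSemisimple (hX : IsSmoothProjective d X) {i : ℕ} {P : ℤ[X]}
    (hP : E.IsIntegralModel X i P) (hss : Module.End.IsSemisimple (E.frobAction X i)) :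
    E.frobIntegralPart X i 0 = ⊤ := by
  haveI := E.finite_obj hX i
  obtain ⟨R, hRm, hR⟩ := E.exists_monic_map_eq_charpoly_frobAction hX hP
  refine (E.frobIntegralPart_eq_top_iff hX i 0).mpr ⟨hss, R, hRm, ?_⟩
  rw [smul_frobenius_zero, hR]
  exact LinearMap.aeval_self_charpoly _

/-- **`F^0_b Hⁱ(X) = Hⁱ(X) ⟺ SS^i(X)`** (the Frobenius acts semisimply on `Hⁱ(X)`), for `X` smooth
projective with an integral model of `P_i(X, T)` — §1.1: `Hⁱ_l(X)` is an effective Tate structure, so by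
Rem. 1.4 `F^0_b Hⁱ_l(X)`, the largest effective semisimple substructure, is everything iff `Hⁱ_l(X)` is
semisimple. [cite: MilneRamachandran2006, §1.1 and Rem. 1.4] [cite: Deligne1974, Thm. (1.6)] -/
theorem frobIntegralPart_zero_eq_top_iff (hX : IsSmoothProjective d X) {i : ℕ} {P : ℤ[X]}
    (hP : E.IsIntegralModel X i P) :
    E.frobIntegralPart X i 0 = ⊤ ↔ Module.End.IsSemisimple (E.frobAction X i) :=
  ⟨fun h ↦ E.isSemisimple_frobAction_of_frobIntegralPart_eq_top hX h,
    E.frobIntegralPart_zero_eq_top_of_isSemisimple hX hP⟩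

/-- Degrees above `2 dim X` are trivial: `Hⁱ(X) = 0`, so `F^r_b Hⁱ(X) = Hⁱ(X)`.
[cite: MilneRamachandran2006, §1 Rem. 1.4] -/
theorem frobIntegralPart_eq_top_of_lt (hX : IsSmoothProjective d X) {i : ℕ} (hi : 2 * d < i) (r : ℕ) :
    E.frobIntegralPart X i r = ⊤ := by
  haveI := E.subsingleton_obj hX hi
  exact eq_top_iff.mpr fun v _ ↦ by rw [Subsingleton.elim v 0]; exact Submodule.zero_mem _

/-- **`F^0_b Hⁱ(X) = Hⁱ(X) ⟺ SS^i(X)` under the Riemann hypothesis for `X`** (which supplies the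
integral models of the `P_i(X, T)`, `i ≤ 2 dim X`; larger `i` are trivial).
[cite: MilneRamachandran2006, §1.1 and Rem. 1.4] [cite: Deligne1974, Thm. (1.6)] -/
theorem frobIntegralPart_zero_eq_top_iff_of_weilRiemannHypothesis (hX : IsSmoothProjective d X)
    (hRH : E.WeilRiemannHypothesisFor X d) (i : ℕ) :
    E.frobIntegralPart X i 0 = ⊤ ↔ Module.End.IsSemisimple (E.frobAction X i) := by
  by_cases hi : i ≤ 2 * d
  · obtain ⟨P, hP, -⟩ := hRH
    exact E.frobIntegralPart_zero_eq_top_iff hX (hP ⟨i, by omega⟩)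
  · exact ⟨fun _ ↦ E.isSemisimple_frobAction_of_lt hX (by omega),
      fun _ ↦ E.frobIntegralPart_eq_top_of_lt hX (by omega) 0⟩

/-- **`S^d(X × X) ⟹ F^0_b Hⁱ(X) = Hⁱ(X)` for every `i`** (`X` smooth projective of dimension `d` over
`𝔽_q` satisfying the Riemann hypothesis): Kahn 2020 Th. 6.54 gives `SS^i(X)` for all `i` (row g39-#7,
`isSemisimple_frobAction_of_strongTate_self_product`), and §1.1/Rem. 1.4 turn it into `F^0_b = Hⁱ`
(§1.1: `Hⁱ_l(X)` «is semisimple […] if the full Tate conjecture holds for `X × X`»).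
[cite: MilneRamachandran2006, §1.1 and Rem. 1.4] [cite: Kahn2020, §6.14 Th. 6.54] -/
theorem frobIntegralPart_zero_eq_top_of_strongTate_self_product (hX : IsSmoothProjective d X)
    (hRH : E.WeilRiemannHypothesisFor X d)
    (hS : LinearMap.ker (E.ρTwist (X ⊗ X) (2 * d) d (geomFrob k) - 1) ⊓
      LinearMap.range (E.ρTwist (X ⊗ X) (2 * d) d (geomFrob k) - 1) = ⊥) (i : ℕ) :
    E.frobIntegralPart X i 0 = ⊤ :=
  (E.frobIntegralPart_zero_eq_top_iff_of_weilRiemannHypothesis hX hRH i).mpr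
    (E.isSemisimple_frobAction_of_strongTate_self_product hX hS i)

/-- **Under `S^d(X × X)` (and the Riemann hypothesis) every `ρ(g)`, `g ∈ Γ_k`, acts semisimply on
`F^0_b Hⁱ(X) = Hⁱ(X)`** — recorded as: `SS^i(X)` in the tree's endomorphism sense for the geometric
Frobenius together with `F^0_b = ⊤`. [cite: MilneRamachandran2006, §1.1] [cite: Kahn2020, §6.14 Th. 6.54] -/
theorem frobIntegralPart_zero_eq_top_and_isSemisimple_of_strongTate_self_product
    (hX : IsSmoothProjective d X) (hRH : E.WeilRiemannHypothesisFor X d)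
    (hS : LinearMap.ker (E.ρTwist (X ⊗ X) (2 * d) d (geomFrob k) - 1) ⊓
      LinearMap.range (E.ρTwist (X ⊗ X) (2 * d) d (geomFrob k) - 1) = ⊥) (i : ℕ) :
    E.frobIntegralPart X i 0 = ⊤ ∧ Module.End.IsSemisimple (E.frobAction X i) :=
  ⟨E.frobIntegralPart_zero_eq_top_of_strongTate_self_product hX hRH hS i,
    E.isSemisimple_frobAction_of_strongTate_self_product hX hS i⟩

end GaloisWeilCohomology

end Literature.AlgebraicGeometry.Motives

end
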